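import Summits.HubbardSuperconductivity.HubbardSuperconductivity.Theorems.AnisotropyChordTransferFibre3RowCLamIncrement

/-!
# Route `AnisotropyChord` / H0 rotor rung: PartN41-C §4 on the t-BLOCKS — the λ-increment bound `|δ_λ(b) − δ_λ(b − e)| ≤ 0.0022`
for `L ≥ 64`

`…Fibre3RowCLamIncrement` (p1 g27) proves `|δ_λ(b) − δ_λ(b−e)| ≤ 0.001` for `L ≥ 128` (box sum of the lattice weights `≤ 28`
with the inner region `|m|∞ ≤ L/8 ≥ 16`, then `≤ 0.0513·7/(πL)`).  That constant is genuinely `L`-dependent (`∝ 1/L`;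
`0.001` needs `L ≥ 115`).  For the t-blocks with floor `L₀ ≥ 64` (route-lead ruling R1; inventory memo
HOME/hubbard-h0-rotor-p2/TBLOCK-INVENTORY-g8.md, item 12) this file re-derives it honestly:
* `ring_num_outer9` (outer rings from `t ≥ 9`: `8/(0.2(0.4t² − κ)) ≤ 100.2/t²`), ★ `box_weight_sum_le8` (`8 ≤ N₁`: box sum `≤ 34`),
  ★ `torus_sum_le_box64` (`≤ 34/(2θ³)`), ★★ `lam_increment_bound64`: **`|δ_λ(b) − δ_λ(b − e)| ≤ 0.0022`** for `L ≥ 64`,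
  `0 ≤ λ₂ ≤ 0.0513θ²`, `e` a nearest neighbour (`≤ 0.0513·17/(2πL) ≤ 0.00217`).
So a row-C program on the blocks must use `0.0022` where the `L ≥ 128` program uses the typed `0.001` (`LamIncrementBound`).
Prover seat `hubbard-h0-rotor-p2` g8; helper for stmt-HubbardSuperconductivity-23918 (`--supports`, helper class).
WHAT THIS IS NOT: nothing here proves superconductivity in the Hubbard model; one L-uniform constant of ONE row of ONE conditional
reduction on the t-blocks.  Tree imports only; no new definitions; no sorry.
-/

set_option linter.dupNamespace false
set_option autoImplicit false

noncomputable section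

open scoped BigOperators

namespace Summit.HubbardSuperconductivity.HubbardSuperconductivity.Theorems.AnisotropyChord.Transfer.Fibre3

namespace RowC

open RateLemma

/-- the per-ring numerics, outer region from `t ≥ 9`: `8/(0.2(0.4t² − κ)) ≤ 100.2/t²`. [folklore] -/
theorem ring_num_outer9 (t : ℝ) (ht : 9 ≤ t) :
    8 * t * (1 / (0.2 * t * (2 * 0.2 * t ^ 2 - 0.0513))) ≤ 100.2 * (1 / t ^ 2) := by
  have ht0 : 0 < t := by linarith
  have hden : 0 < 2 * 0.2 * t ^ 2 - 0.0513 := by nlinarith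
  rw [show 8 * t * (1 / (0.2 * t * (2 * 0.2 * t ^ 2 - 0.0513))) = 8 / (0.2 * (2 * 0.2 * t ^ 2 - 0.0513)) by
    field_simp]
  rw [div_le_iff₀ (by positivity), show (100.2 : ℝ) * (1 / t ^ 2) * (0.2 * (2 * 0.2 * t ^ 2 - 0.0513))
    = 100.2 * 0.2 * (2 * 0.2 * t ^ 2 - 0.0513) / t ^ 2 by field_simp]
  rw [le_div_iff₀ (by positivity)]
  nlinarith

/-- ★ `Σ_{m ∈ box∖0} |mᵢ| / (c_m |m|² (2c_m|m|² − κ)) ≤ 34` for `8 ≤ N₁ ≤ N` (`κ = 0.0513`; `c_m = 0.47` on `|m|∞ ≤ N₁`,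
`0.2` beyond). [folklore] -/
theorem box_weight_sum_le8 (N₁ N : ℕ) (hN₁ : 8 ≤ N₁) (hN : N₁ ≤ N) (i : Bool) :
    ∑ m ∈ puncturedBox N,
        ((if i then m.1 else m.2).natAbs : ℝ)
          / ((if m.1.natAbs ≤ N₁ ∧ m.2.natAbs ≤ N₁ then (0.47 : ℝ) else 0.2)
              * (((m.1 ^ 2 + m.2 ^ 2 : ℤ)) : ℝ)
              * (2 * (if m.1.natAbs ≤ N₁ ∧ m.2.natAbs ≤ N₁ then (0.47 : ℝ) else 0.2)
                  * (((m.1 ^ 2 + m.2 ^ 2 : ℤ)) : ℝ) - 0.0513)) ≤ 34 := by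
  set g : ℤ × ℤ → ℝ := fun m => ((if i then m.1 else m.2).natAbs : ℝ)
          / ((if m.1.natAbs ≤ N₁ ∧ m.2.natAbs ≤ N₁ then (0.47 : ℝ) else 0.2)
              * (((m.1 ^ 2 + m.2 ^ 2 : ℤ)) : ℝ)
              * (2 * (if m.1.natAbs ≤ N₁ ∧ m.2.natAbs ≤ N₁ then (0.47 : ℝ) else 0.2)
                  * (((m.1 ^ 2 + m.2 ^ 2 : ℤ)) : ℝ) - 0.0513)) with hg
  show ∑ m ∈ puncturedBox N, g m ≤ 34
  -- split off the innermost ring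
  have hsplit : ∑ m ∈ puncturedBox N, g m
      = (∑ m ∈ puncturedBox 1, g m) + ∑ m ∈ puncturedBox N \ puncturedBox 1, g m := by
    rw [Finset.sum_sdiff_eq_sub (puncturedBox_subset (by omega : 1 ≤ N))]; ring
  -- (1) the innermost ring: at most 7.12
  have h1 : ∑ m ∈ puncturedBox 1, g m ≤ 7.12 := by
    have hin : ∀ a b : ℤ, a.natAbs ≤ 1 → b.natAbs ≤ 1 → (a.natAbs ≤ N₁ ∧ b.natAbs ≤ N₁) := fun a b ha hb => ⟨by omega, by omega⟩
    rw [pbox_one_eq]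
    rw [Finset.sum_insert (by decide), Finset.sum_insert (by decide), Finset.sum_insert (by decide),
      Finset.sum_insert (by decide), Finset.sum_insert (by decide), Finset.sum_insert (by decide),
      Finset.sum_insert (by decide), Finset.sum_singleton]
    simp only [hg, if_pos (hin (-1) (-1) (by norm_num) (by norm_num)), if_pos (hin (-1) 0 (by norm_num) (by norm_num)),
      if_pos (hin (-1) 1 (by norm_num) (by norm_num)), if_pos (hin 0 (-1) (by norm_num) (by norm_num)),
      if_pos (hin 0 1 (by norm_num) (by norm_num)), if_pos (hin 1 (-1) (by norm_num) (by norm_num)),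
      if_pos (hin 1 0 (by norm_num) (by norm_num)), if_pos (hin 1 1 (by norm_num) (by norm_num))]
    cases i <;> simp <;> norm_num
  -- (2) the rings `2 ≤ n+1`: ring-wise bound
  set φ : ℕ → ℝ := fun n => if n + 1 ≤ N₁ then 1 / (0.47 * ((n : ℝ) + 1) * (2 * 0.47 * ((n : ℝ) + 1) ^ 2 - 0.0513))
      else 1 / (0.2 * ((n : ℝ) + 1) * (2 * 0.2 * ((n : ℝ) + 1) ^ 2 - 0.0513)) with hφ
  have hring : ∀ n : ℕ, 1 ≤ n → n < N → ∀ m ∈ puncturedBox (n + 1) \ puncturedBox n, g m ≤ φ n := by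
    intro n hn _ m hm
    obtain ⟨hm1, hm2, hsq, hmax⟩ := ring_facts n m hm
    have ht : (2 : ℝ) ≤ (n : ℝ) + 1 := by
      have : (1 : ℝ) ≤ n := by exact_mod_cast hn
      linarith
    have hsel : ((if i then m.1 else m.2).natAbs : ℝ) ≤ (n : ℝ) + 1 := by
      cases i
      · simp only [Bool.false_eq_true, if_false]; exact hm2
      · simp only [if_true]; exact hm1
    have hreg : (m.1.natAbs ≤ N₁ ∧ m.2.natAbs ≤ N₁) ↔ n + 1 ≤ N₁ := by
      constructor
      · rintro ⟨a1, a2⟩; rcases hmax with h | h <;> omega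
      · intro h
        have h' : (((n + 1 : ℕ)) : ℝ) ≤ (N₁ : ℝ) := by exact_mod_cast h
        push_cast at h'
        have a1 : (m.1.natAbs : ℝ) ≤ N₁ := hm1.trans h'
        have a2 : (m.2.natAbs : ℝ) ≤ N₁ := hm2.trans h'
        exact ⟨by exact_mod_cast a1, by exact_mod_cast a2⟩
    by_cases hr : n + 1 ≤ N₁
    · have hc : (if m.1.natAbs ≤ N₁ ∧ m.2.natAbs ≤ N₁ then (0.47 : ℝ) else 0.2) = 0.47 := if_pos (hreg.mpr hr)
      have hφn : φ n = 1 / (0.47 * ((n : ℝ) + 1) * (2 * 0.47 * ((n : ℝ) + 1) ^ 2 - 0.0513)) := by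
        rw [hφ]; simp only [if_pos hr]
      rw [hg]; simp only [hc]; rw [hφn]
      exact weight_le 0.47 _ _ _ (by norm_num) (by linarith) hsel hsq (by nlinarith)
    · have hc : (if m.1.natAbs ≤ N₁ ∧ m.2.natAbs ≤ N₁ then (0.47 : ℝ) else 0.2) = 0.2 :=
        if_neg (fun h => hr (hreg.mp h))
      have hφn : φ n = 1 / (0.2 * ((n : ℝ) + 1) * (2 * 0.2 * ((n : ℝ) + 1) ^ 2 - 0.0513)) := by
        rw [hφ]; simp only [if_neg hr]
      rw [hg]; simp only [hc]; rw [hφn]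
      exact weight_le 0.2 _ _ _ (by norm_num) (by linarith) hsel hsq (by nlinarith)
  have h2 := sum_sdiff_pbox_le g φ 1 N (by omega) hring
  -- (3) the ring sums
  have h3 : ∑ n ∈ Finset.Ico 1 N, 8 * ((n : ℝ) + 1) * φ n ≤ 18.4 * (3 / 4) + 100.2 / 8 := by
    rw [← Finset.sum_Ico_consecutive _ (by omega : 1 ≤ N₁) hN]
    have hin : ∑ n ∈ Finset.Ico 1 N₁, 8 * ((n : ℝ) + 1) * φ n ≤ 18.4 * (3 / 4) := by
      have hle : ∀ n ∈ Finset.Ico 1 N₁, 8 * ((n : ℝ) + 1) * φ n ≤ 18.4 * (1 / (((n + 1 : ℕ)) : ℝ) ^ 2) := by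
        intro n hn
        rw [Finset.mem_Ico] at hn
        rw [hφ]; simp only [if_pos (show n + 1 ≤ N₁ by omega)]
        push_cast
        have h1n : (1 : ℝ) ≤ n := by exact_mod_cast hn.1
        exact ring_num_inner _ (by linarith)
      refine (Finset.sum_le_sum hle).trans ?_
      rw [← Finset.mul_sum, sum_Ico_shift_one (fun j => (1 : ℝ) / (j : ℝ) ^ 2) 1 N₁]
      have hs2 : ∑ j ∈ Finset.Icc (1 + 1) N₁, (1 : ℝ) / (j : ℝ) ^ 2
          = 1 / 4 + ∑ j ∈ Finset.Icc (2 + 1) N₁, (1 : ℝ) / (j : ℝ) ^ 2 := by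
        have : Finset.Icc (1 + 1) N₁ = insert 2 (Finset.Icc (2 + 1) N₁) := by
          ext j; simp only [Finset.mem_Icc, Finset.mem_insert]; omega
        rw [this, Finset.sum_insert (by simp)]
        norm_num
      rw [hs2]
      have := sum_inv_sq_Icc_le 2 N₁ (by norm_num)
      nlinarith
    have hout : ∑ n ∈ Finset.Ico N₁ N, 8 * ((n : ℝ) + 1) * φ n ≤ 100.2 / 8 := by
      have hle : ∀ n ∈ Finset.Ico N₁ N, 8 * ((n : ℝ) + 1) * φ n ≤ 100.2 * (1 / (((n + 1 : ℕ)) : ℝ) ^ 2) := by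
        intro n hn
        rw [Finset.mem_Ico] at hn
        rw [hφ]; simp only [if_neg (show ¬ (n + 1 ≤ N₁) by omega)]
        push_cast
        have hNn : ((N₁ : ℝ)) ≤ n := by exact_mod_cast hn.1
        have h8' : (8 : ℝ) ≤ N₁ := by exact_mod_cast hN₁
        exact ring_num_outer9 _ (by linarith)
      refine (Finset.sum_le_sum hle).trans ?_
      rw [← Finset.mul_sum, sum_Ico_shift_one (fun j => (1 : ℝ) / (j : ℝ) ^ 2) N₁ N]
      have h16 := sum_inv_sq_Icc_le N₁ N (by omega)
      have hN8 : (1 : ℝ) / N₁ ≤ 1 / 8 := by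
        apply one_div_le_one_div_of_le (by norm_num); exact_mod_cast hN₁
      nlinarith
    linarith
  rw [hsplit]
  have : (7.12 : ℝ) + (18.4 * (3 / 4) + 100.2 / 8) ≤ 34 := by norm_num
  linarith

/-- ★ the torus sum of the termwise majorants is at most `34/(2θ³)` for `L ≥ 64` (`N₁ = L/8 ≥ 8`). [folklore] -/
theorem torus_sum_le_box64 (L : ℕ) [NeZero L] (hL : 64 ≤ L) (lam2 : ℝ)
    (hl : lam2 ≤ 0.0513 * (2 * Real.pi / L) ^ 2) (i : Bool) :
    (∑ k : Tor L, if k = 0 then (0 : ℝ)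
        else (2 * Real.pi / L) * (((if i then k.1 else k.2).valMinAbs.natAbs : ℕ) : ℝ)
          / ((2 * epsT L k) * (2 * epsT L k - lam2)))
      ≤ 34 / (2 * (2 * Real.pi / L) ^ 3) := by
  set θ : ℝ := 2 * Real.pi / L with hθ
  have hLpos : (0 : ℝ) < L := by exact_mod_cast (show 0 < L by omega)
  have hθpos : 0 < θ := by positivity
  set N₁ : ℕ := L / 8 with hN₁
  set N : ℕ := L / 2 with hN
  have hN₁8 : 8 ≤ N₁ := by omega
  have hN₁N : N₁ ≤ N := by omega
  have h8 : 8 * N₁ ≤ L := by omega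
  -- the lattice weight
  set g : ℤ × ℤ → ℝ := fun m => ((if i then m.1 else m.2).natAbs : ℝ)
          / ((if m.1.natAbs ≤ N₁ ∧ m.2.natAbs ≤ N₁ then (0.47 : ℝ) else 0.2)
              * (((m.1 ^ 2 + m.2 ^ 2 : ℤ)) : ℝ)
              * (2 * (if m.1.natAbs ≤ N₁ ∧ m.2.natAbs ≤ N₁ then (0.47 : ℝ) else 0.2)
                  * (((m.1 ^ 2 + m.2 ^ 2 : ℤ)) : ℝ) - 0.0513)) with hg
  have hbox : ∑ m ∈ puncturedBox N, g m ≤ 34 := box_weight_sum_le8 N₁ N hN₁8 hN₁N i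
  have hg0 : ∀ m : ℤ × ℤ, 0 ≤ g m := by
    intro m
    rw [hg]; simp only
    by_cases hm : m = (0, 0)
    · rw [hm]; simp
    · apply div_nonneg (by positivity)
      have hq : (1 : ℝ) ≤ (((m.1 ^ 2 + m.2 ^ 2 : ℤ)) : ℝ) := by
        have : (1 : ℤ) ≤ m.1 ^ 2 + m.2 ^ 2 := by
          have : m.1 ≠ 0 ∨ m.2 ≠ 0 := by
            by_contra h; push Not at h; exact hm (Prod.ext h.1 h.2)
          rcases this with h | h
          · have := Int.one_le_abs h; nlinarith [abs_nonneg m.1, sq_abs m.1, sq_nonneg m.2]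
          · have := Int.one_le_abs h; nlinarith [abs_nonneg m.2, sq_abs m.2, sq_nonneg m.1]
        exact_mod_cast this
      have hc : (0.2 : ℝ) ≤ (if m.1.natAbs ≤ N₁ ∧ m.2.natAbs ≤ N₁ then (0.47 : ℝ) else 0.2) := by
        split_ifs <;> norm_num
      have : 0 < (if m.1.natAbs ≤ N₁ ∧ m.2.natAbs ≤ N₁ then (0.47 : ℝ) else 0.2)
          * (((m.1 ^ 2 + m.2 ^ 2 : ℤ)) : ℝ) := by nlinarith
      have : 0 < 2 * (if m.1.natAbs ≤ N₁ ∧ m.2.natAbs ≤ N₁ then (0.47 : ℝ) else 0.2)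
          * (((m.1 ^ 2 + m.2 ^ 2 : ℤ)) : ℝ) - 0.0513 := by nlinarith
      positivity
  -- termwise domination by `g(rep k)/(2θ³)`
  have hterm : ∀ k : Tor L, (if k = 0 then (0 : ℝ)
      else θ * (((if i then k.1 else k.2).valMinAbs.natAbs : ℕ) : ℝ) / ((2 * epsT L k) * (2 * epsT L k - lam2)))
      ≤ g (k.1.valMinAbs, k.2.valMinAbs) / (2 * θ ^ 3) := by
    intro k
    by_cases hk : k = 0
    · rw [if_pos hk]; exact div_nonneg (hg0 _) (by positivity)
    · rw [if_neg hk]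
      have hq : (1 : ℝ) ≤ ((((k.1.valMinAbs) ^ 2 + (k.2.valMinAbs) ^ 2 : ℤ)) : ℝ) := by
        have : k.1.valMinAbs ≠ 0 ∨ k.2.valMinAbs ≠ 0 := by
          by_contra hcon
          push Not at hcon
          apply hk
          ext
          · simpa using (ZMod.valMinAbs_eq_zero k.1).1 hcon.1
          · simpa using (ZMod.valMinAbs_eq_zero k.2).1 hcon.2
        have h1 : (1 : ℤ) ≤ k.1.valMinAbs ^ 2 + k.2.valMinAbs ^ 2 := by
          rcases this with h | h
          · have := Int.one_le_abs h
            nlinarith [abs_nonneg k.1.valMinAbs, sq_abs k.1.valMinAbs, sq_nonneg k.2.valMinAbs]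
          · have := Int.one_le_abs h
            nlinarith [abs_nonneg k.2.valMinAbs, sq_abs k.2.valMinAbs, sq_nonneg k.1.valMinAbs]
        exact_mod_cast h1
      have hqe : ((((k.1.valMinAbs) ^ 2 + (k.2.valMinAbs) ^ 2 : ℤ)) : ℝ)
          = (((k.1.valMinAbs : ℤ) : ℝ)) ^ 2 + (((k.2.valMinAbs : ℤ) : ℝ)) ^ 2 := by push_cast; ring
      have hsel : (((if i then ((k.1.valMinAbs, k.2.valMinAbs) : ℤ × ℤ).1
            else ((k.1.valMinAbs, k.2.valMinAbs) : ℤ × ℤ).2).natAbs : ℕ) : ℝ)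
          = (((if i then k.1 else k.2).valMinAbs.natAbs : ℕ) : ℝ) := by cases i <;> rfl
      rw [hg]; simp only []
      rw [hsel]
      by_cases hin : k.1.valMinAbs.natAbs ≤ N₁ ∧ k.2.valMinAbs.natAbs ≤ N₁
      · rw [if_pos hin]
        have hE := epsT_ge_inner L k N₁ h8 hin.1 hin.2
        rw [← hqe] at hE
        exact term_le θ _ (epsT L k) lam2 _ 0.47 hθpos (by positivity) (by norm_num) hq
          (by linarith) hl
      · rw [if_neg hin]
        have hE := epsT_ge_outer L k
        rw [← hqe] at hE
        exact term_le θ _ (epsT L k) lam2 _ 0.2 hθpos (by positivity) le_rfl hq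
          (by linarith) hl
  have s1 : (∑ k : Tor L, if k = 0 then (0 : ℝ)
        else θ * (((if i then k.1 else k.2).valMinAbs.natAbs : ℕ) : ℝ) / ((2 * epsT L k) * (2 * epsT L k - lam2)))
      ≤ ∑ k : Tor L, g (k.1.valMinAbs, k.2.valMinAbs) / (2 * θ ^ 3) :=
    Finset.sum_le_sum fun k _ => hterm k
  refine s1.trans ?_
  rw [← Finset.sum_div]
  apply div_le_div_of_nonneg_right _ (by positivity)
  have s2 : (∑ k : Tor L, g (k.1.valMinAbs, k.2.valMinAbs))
      = ∑ m ∈ (Finset.univ : Finset (Tor L)).image (fun k : Tor L => (k.1.valMinAbs, k.2.valMinAbs)), g m := by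
    rw [Finset.sum_image (fun a _ b _ h => rep_injective L h)]
  set box : Finset (ℤ × ℤ) := (Finset.Icc (-(N : ℤ)) N) ×ˢ (Finset.Icc (-(N : ℤ)) N) with hboxdef
  have s3 : (Finset.univ : Finset (Tor L)).image (fun k : Tor L => (k.1.valMinAbs, k.2.valMinAbs)) ⊆ box := by
    rw [Finset.image_subset_iff]
    intro k _
    rw [hboxdef, hN]
    exact rep_mem_box L k
  have s4 := Finset.sum_le_sum_of_subset_of_nonneg s3 (fun m _ _ => hg0 m)
  have h0mem : ((0 : ℤ), (0 : ℤ)) ∈ box := by rw [hboxdef]; simp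
  have s5 : (∑ m ∈ box, g m) = ∑ m ∈ puncturedBox N, g m := by
    have hpb : puncturedBox N = box.erase ((0 : ℤ), (0 : ℤ)) := rfl
    rw [hpb, ← Finset.sum_erase_add box _ h0mem]
    have hz : g ((0 : ℤ), (0 : ℤ)) = 0 := by rw [hg]; simp
    rw [hz, add_zero]
  calc (∑ k : Tor L, g (k.1.valMinAbs, k.2.valMinAbs)) = _ := s2
    _ ≤ ∑ m ∈ box, g m := s4
    _ = ∑ m ∈ puncturedBox N, g m := s5
    _ ≤ 34 := hbox

/-- ★★ `|δ_λ(b) − δ_λ(b − e)| ≤ 0.0022` on the blocks (`L ≥ 64`, `0 ≤ λ₂ ≤ 0.0513θ²`, `e` a nearest neighbour; value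
`≤ 0.0513·17/(2πL)`). [folklore] -/
theorem lam_increment_bound64 (L : ℕ) [NeZero L] (hL : 64 ≤ L) {lam2 : ℝ} (hl0 : 0 ≤ lam2)
    (hl : lam2 ≤ 0.0513 * (2 * Real.pi / L) ^ 2) {e : Tor L} (he : e ∈ nnList L) (b : Tor L) :
    |lamPart L lam2 b - lamPart L lam2 (b - e)| ≤ 0.0022 := by
  have hLpos : (0 : ℝ) < L := by exact_mod_cast (show 0 < L by omega)
  have hL64 : (64 : ℝ) ≤ L := by exact_mod_cast hL
  set θ : ℝ := 2 * Real.pi / L with hθ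
  have hθpos : 0 < θ := by positivity
  have hV : (0 : ℝ) < (L : ℝ) ^ 2 := by positivity
  -- `λ < 2ε₁`
  have hεJ : 2 / Real.pi ^ 2 * θ ^ 2 ≤ eps1 L := eps1_ge_jordan L (by omega)
  have hπ := Real.pi_lt_d2
  have hπ0 := Real.pi_pos
  have hl2 : lam2 < 2 * eps1 L := by
    have : 0.0513 * θ ^ 2 < 2 * (2 / Real.pi ^ 2 * θ ^ 2) := by
      have hθ2 : 0 < θ ^ 2 := by positivity
      have h4 : (0.0513 : ℝ) < 4 / Real.pi ^ 2 := by
        rw [lt_div_iff₀ (by positivity)]; nlinarith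
      have := mul_lt_mul_of_pos_right h4 hθ2
      have e : 4 / Real.pi ^ 2 * θ ^ 2 = 2 * (2 / Real.pi ^ 2 * θ ^ 2) := by ring
      linarith
    linarith
  -- the difference identity
  have hid := lamPartIdentity_holds L lam2 hl0 hl2
  obtain ⟨i, hi⟩ := natAbs_dot_nn L e he
  have hden : ∀ k : Tor L, k ≠ 0 → 0 < (2 * epsT L k) * (2 * epsT L k - lam2) := by
    intro k hk
    have hε : eps1 L ≤ epsT L k := eps1_le_epsT L (by omega) hk
    apply mul_pos <;> nlinarith [Real.pi_pos]
  have hdiff : lamPart L lam2 b - lamPart L lam2 (b - e)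
      = lam2 * (∑ k : Tor L, if k = 0 then (0 : ℝ)
          else ((phase L k (b - e)).re - (phase L k b).re) / ((2 * epsT L k) * (2 * epsT L k - lam2))) / (L : ℝ) ^ 2 := by
    rw [hid b, hid (b - e)]
    unfold lamPartSum
    rw [← sub_div, ← mul_sub, ← Finset.sum_sub_distrib]
    congr 2
    refine Finset.sum_congr rfl fun k _ => ?_
    split_ifs <;> ring
  have habs : |lamPart L lam2 b - lamPart L lam2 (b - e)|
      ≤ lam2 * (∑ k : Tor L, if k = 0 then (0 : ℝ)
          else θ * (((if i then k.1 else k.2).valMinAbs.natAbs : ℕ) : ℝ)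
            / ((2 * epsT L k) * (2 * epsT L k - lam2))) / (L : ℝ) ^ 2 := by
    rw [hdiff, abs_div, abs_mul, abs_of_nonneg hl0, abs_of_pos hV]
    apply div_le_div_of_nonneg_right _ hV.le
    apply mul_le_mul_of_nonneg_left _ hl0
    refine (Finset.abs_sum_le_sum_abs _ _).trans (Finset.sum_le_sum fun k _ => ?_)
    by_cases hk : k = 0
    · rw [if_pos hk, if_pos hk, abs_zero]
    · rw [if_neg hk, if_neg hk, abs_div, abs_of_pos (hden k hk)]
      apply div_le_div_of_nonneg_right _ (hden k hk).le
      rw [← hi k]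
      exact abs_re_phase_shift_sub_le L k b e
  have hbox := torus_sum_le_box64 L hL lam2 hl i
  have hsum0 : 0 ≤ ∑ k : Tor L, (if k = 0 then (0 : ℝ)
      else θ * (((if i then k.1 else k.2).valMinAbs.natAbs : ℕ) : ℝ) / ((2 * epsT L k) * (2 * epsT L k - lam2))) := by
    refine Finset.sum_nonneg fun k _ => ?_
    by_cases hk : k = 0
    · rw [if_pos hk]
    · rw [if_neg hk]; exact div_nonneg (by positivity) (hden k hk).le
  calc |lamPart L lam2 b - lamPart L lam2 (b - e)|
      ≤ lam2 * (∑ k : Tor L, if k = 0 then (0 : ℝ)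
          else θ * (((if i then k.1 else k.2).valMinAbs.natAbs : ℕ) : ℝ)
            / ((2 * epsT L k) * (2 * epsT L k - lam2))) / (L : ℝ) ^ 2 := habs
    _ ≤ (0.0513 * θ ^ 2) * (34 / (2 * θ ^ 3)) / (L : ℝ) ^ 2 := by
        apply div_le_div_of_nonneg_right _ hV.le
        exact mul_le_mul hl hbox hsum0 (by positivity)
    _ = 0.0513 * 17 / (2 * Real.pi * L) := by
        rw [hθ]; field_simp; ring
    _ ≤ 0.0022 := by
        rw [div_le_iff₀ (by positivity)]
        have hπ3 := Real.pi_gt_d2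
        nlinarith [mul_le_mul_of_nonneg_left hL64 (le_of_lt hπ0), hπ3]

end RowC

end Summit.HubbardSuperconductivity.HubbardSuperconductivity.Theorems.AnisotropyChord.Transfer.Fibre3

end
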